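import Literature.AlgebraicGeometry.Frobenioids.MotivatingExamplesSub
import Literature.AlgebraicGeometry.Frobenioids.ArithmeticFrobenioidHypotheses
import Literature.AlgebraicGeometry.Frobenioids.ModelFrobenioidBiratNormalized
import Literature.AlgebraicGeometry.Frobenioids.CoAngularPreSteps
import HarnessLib

/-!
# Frobenioids I, §6: the Frobenioids of Examples 6.1 / 6.3 are of birationally Frobenius-normalized type

Mochizuki, *The geometry of Frobenioids I: the general theory*, Kyushu J. Math. **62** (2008)
293–400, §6: Theorem 6.2 (iii) p. 111 l. 30–31 and Example 6.3 p. 113 l. 21 ("of model — hence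
birationally Frobenius-normalized — type", via Thm. 5.2 (ii) p. 101 and Def. 4.5 (i) p. 86)
[cite: MochizukiFrdI2008, Ex. 6.3 p.113] [cite: MochizukiFrdI2008, Thm. 6.2 (iii) p.111].

PROOF-ONLY file (sub-DAG `plan/L1/SUBDAG-FrdI-Thm64.md` rows E63/L08 `Ex63_biratFrobeniusNormalized` and
T62iii/L02 `Thm62_biratFrobeniusNormalized`; instances offered by abc-iut-L1-d10 to the S3 holder
abc-iut-L6-t10): both are INSTANCES of [FrdI] Thm. 5.2 (ii) `ModelFrobenioid.isOfBiratFrobeniusNormalizedType`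
(`ModelFrobenioidBiratNormalized.lean`) at THE birationalization `PreFrobenioid.biratData`
(seats abc-iut-L6-t8/L6-t6), since `C_{K/F}` (Ex. 6.3) and `C_{K̃/K}` (Ex. 6.1) are the model Frobenioids of
their data (abc-iut-L6-t10's `arithFrobenioid` / `geomFrobenioid`):
* Ex. 6.3, `K/F` Galois: PREMISE-FREE up to the square-completion input `hsq` (also supplied,
  `Ex63_hasBiratSquares`), using abc-iut-L6-t10's proved hypotheses `arith_hypotheses`;
* Thm. 6.2: modulo the typed standing hypotheses `Thm62_geomHypotheses Γ` (row T62ii/L03).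
No definitions; the E63/L06 discharge name is NOT declared here (holder abc-iut-L6-t10).
-/

namespace Literature.AlgebraicGeometry.Frobenioids

open CategoryTheory

/-! ### Example 6.3: the arithmetic Frobenioid `C_{K/F}` -/

section Ex63

variable (F : Type) [Field F] [NumberField F] (K : Type) [Field K] [Algebra F K] [IsGalois F K]

/-- The square-completion property ([FrdI] Prop. 1.11 (vii)) of `C_{K/F} → F_Φ`, the input `hsq` of its
birationalization (abc-iut-L1-t1's `exists_coAngular_square`). [cite: MochizukiFrdI2008, Ex. 6.3 p.113] -/
theorem Ex63_hasBiratSquares :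
    PreFrobenioid.HasBiratSquares
      (ModelFrobenioid.toElem (arithDivisorFunctor F K) (unitsFunctor F K) (divNatTrans F K)) :=
  fun _ _ _ φ β hβ =>
    PreFrobenioid.exists_coAngular_square
      (Ex63_isFrobenioid_of_hypotheses F K (arith_hypotheses F K)) β hβ φ

/-- **E63/L08** — `C_{K/F}` is of birationally Frobenius-normalized type ([FrdI] Def. 4.5 (i)) with respect
to THE birationalization, for `K/F` Galois: [FrdI] Thm. 5.2 (ii) `ModelFrobenioid.isOfBiratFrobeniusNormalizedType`
at abc-iut-L6-t10's `arith_hypotheses` (`Φ` divisorial, `B` group-like). [cite: MochizukiFrdI2008, Ex. 6.3 p.113] -/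
theorem Ex63_isOfBiratFrobeniusNormalizedType
    (hsq : PreFrobenioid.HasBiratSquares
      (ModelFrobenioid.toElem (arithDivisorFunctor F K) (unitsFunctor F K) (divNatTrans F K))) :
    PreFrobenioidData.IsOfBiratFrobeniusNormalizedType
      (PreFrobenioid.biratData (Ex63_isFrobenioid_of_hypotheses F K (arith_hypotheses F K)) hsq) :=
  ModelFrobenioid.isOfBiratFrobeniusNormalizedType_of_isDivisorial _ hsq
    (arith_hypotheses F K).isDivisorial (arith_hypotheses F K).isGroupLike_rat

/-- **E63/L08**, with the square-completion input supplied. [cite: MochizukiFrdI2008, Ex. 6.3 p.113] -/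
theorem Ex63_isOfBiratFrobeniusNormalizedType' :
    PreFrobenioidData.IsOfBiratFrobeniusNormalizedType
      (PreFrobenioid.biratData (Ex63_isFrobenioid_of_hypotheses F K (arith_hypotheses F K))
        (Ex63_hasBiratSquares F K)) :=
  Ex63_isOfBiratFrobeniusNormalizedType F K _

end Ex63

/-! ### Theorem 6.2 (iii): the Frobenioid of geometric origin `C_{K̃/K}` -/

section Thm62

variable {K : Type} [Field K] {Kt : Type} [Field Kt] [Algebra K Kt] (Γ : GeometricDivisorData K Kt)

/-- The square-completion property of `C_{K̃/K} → F_Φ` under the standing hypotheses T62ii/L03.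
[cite: MochizukiFrdI2008, Thm. 6.2 p.110] -/
theorem Thm62_hasBiratSquares_of_hypotheses (h : Thm62_geomHypotheses Γ) :
    PreFrobenioid.HasBiratSquares
      (ModelFrobenioid.toElem (geomDivisorFunctor Γ) (geomUnitsFunctor Γ) (geomDivNatTrans Γ)) :=
  fun _ _ _ φ β hβ =>
    PreFrobenioid.exists_coAngular_square (Thm62_geomIsFrobenioid_of_hypotheses Γ h) β hβ φ

/-- **T62iii/L02** — `C_{K̃/K}` is of birationally Frobenius-normalized type (Thm. 6.2 (iii) "model — hence
birationally Frobenius-normalized — type", p. 111) with respect to THE birationalization, modulo the typed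
standing hypotheses of Thm. 5.2 (`Thm62_geomHypotheses Γ`, row T62ii/L03).
[cite: MochizukiFrdI2008, Thm. 6.2 (iii) p.111] -/
theorem Thm62_isOfBiratFrobeniusNormalizedType_of_hypotheses (h : Thm62_geomHypotheses Γ)
    (hsq : PreFrobenioid.HasBiratSquares
      (ModelFrobenioid.toElem (geomDivisorFunctor Γ) (geomUnitsFunctor Γ) (geomDivNatTrans Γ))) :
    PreFrobenioidData.IsOfBiratFrobeniusNormalizedType
      (PreFrobenioid.biratData (Thm62_geomIsFrobenioid_of_hypotheses Γ h) hsq) :=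
  ModelFrobenioid.isOfBiratFrobeniusNormalizedType_of_isDivisorial _ hsq h.isDivisorial h.isGroupLike_rat

end Thm62

end Literature.AlgebraicGeometry.Frobenioids
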